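import Literature.AnabelianGeometry.SemiGraphs.ProSigmaCompletionNormalCentralizer
import Literature.AnabelianGeometry.AbsoluteAnabelian.AbsTopIThm26GeomCentralizerRoute
import HarnessLib

/-!
# The «projectivity route» to «`Δ ⊆ Π` characteristic» with its classical input (H′) DISCHARGED:
# a commuting pair inside a free profinite `Δ_E` is impossible, so `φ` preserves `Δ`

S. Mochizuki, *Topics in Absolute Anabelian Geometry I: Generalities*, J. Math. Sci. Univ. Tokyo **19** (2012)
[AbsTopI], Thm 2.6 (iv)/(v) p. 22 [cite: MochizukiAbsTopI2012, Thm 2.6 (v) p.22]; [AbsAnab] Lemma 1.3.8 p. 18,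
Lemma 1.3.1 p. 15 [cite: MochizukiAbsAnab2004, Lemma 1.3.1 p.15].

Cell `abc-iut`, seat abc-iut-w4-d044 (gen 7), row «HPRIME-PROVED» (abc-iut-L6-lead §F v1.19cc (ii): «state … the
one-line corollary that kills the second disjunct of p473904 in the shape that file exports»).  PROOF-ONLY, no
definition, no instance, no named fact; consumes BY NAME abc-iut-w6-d055's
`FundamentalExtension.MLFBase.preservesGeom_or_exists_commuting_pair` (p473904) and this seat's
`IsProSigmaCompletion.centralizer_eq_bot_of_normal` family (`SemiGraphs/ProSigmaCompletionNormalCentralizer.lean`).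

WHAT IS SHOWN.  Write «(H′) for `Δ_E`» for the property
`∀ N : Subgroup Δ_E, N.Normal → N ≠ ⊥ → Subgroup.centralizer N = ⊥` (spelled out inline; no `def`).
* `centralizer_eq_bot_of_normal_of_mulEquiv` — (H′) transports along any group isomorphism;
* `FundamentalExtension.eq_bot_of_commuting_pair` — under (H′) for `Δ_E`: subgroups `R₀, S ≤ Δ_E` of `Π_E` with
  `R₀ ⊴ Π_E`, `R₀ ≠ 1`, commuting elementwise force `S = 1`;
* **`FundamentalExtension.MLFBase.preservesGeom_of_centralizer_eq_bot`** — p473904 with its second disjunct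
  KILLED: the same binders `BE BF hΔE hΔF hslim φ hℓ hbal A hA hAU` plus (H′) for `Δ_E` give `PreservesGeom φ`;
* (H′)-SUPPLIERS for `Δ_E` BY NAME (theorems, not hypotheses): `FundamentalExtension.hprime_geom_of_mulEquiv_freeProfinite`
  (`Δ_E ≃* F̂_n`, `n ≥ 2`), `…_of_mulEquiv_isOpen_freeProfinite` (`Δ_E ≃*` an open subgroup of `F̂_n`),
  `…_of_isFreeProOn` (`Δ_E` free pro-`𝔓𝔯𝔦𝔪𝔢𝔰` of rank `≥ 2` in the sense of [AbsTopI] Lemma 4.5 (i)).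
So at any extension whose `Δ_E` is a free profinite group of finite rank `≥ 2` (or an open subgroup of one), the
MCHAR/«`Δ ⊆ Π` characteristic» route carries NO classical named hypothesis: only its `δ¹`-balance / MLF-base /
centralising-subgroup inputs.

HONEST FRAMING: group theory over the tree's typed [AbsTopI] vocabulary; NOT a verdict on (H1) at any model (the model
plumbing is the (ii-b) holder's); nothing here bears on [IUTchIII] Cor. 3.12 or takes a side; typed ≠ proved elsewhere;
nothing asserts abc proved or refuted.
-/

namespace Literature.AnabelianGeometry.AbsoluteAnabelian

open Literature.AlgebraicGeometry.Frobenioids (IsSlimGroup)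
open Literature.AnabelianGeometry.SemiGraphs.SemiGraphOfAnabelioids (IsProSigmaCompletion)
open Literature.IUT.HodgeTheaters (profiniteCompletion)

/-! ### Transport of (H′) along group isomorphisms -/

/-- (H′) — «every non-trivial normal subgroup has trivial centraliser» — transports along any group isomorphism
`e : G ≃* H`. [cite: MochizukiAbsAnab2004, Lemma 1.3.1 p.15] -/
theorem centralizer_eq_bot_of_normal_of_mulEquiv {G H : Type*} [Group G] [Group H] (e : G ≃* H)
    (hH : ∀ N : Subgroup H, N.Normal → N ≠ ⊥ → Subgroup.centralizer (N : Set H) = ⊥)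
    (N : Subgroup G) (hN : N.Normal) (hN0 : N ≠ ⊥) : Subgroup.centralizer (N : Set G) = ⊥ := by
  haveI : (N.map e.toMonoidHom).Normal := hN.map e.toMonoidHom e.surjective
  have hne : N.map e.toMonoidHom ≠ ⊥ := by
    intro h
    apply hN0
    rw [eq_bot_iff] at h ⊢
    intro n hn
    have := h ⟨n, hn, rfl⟩
    rw [Subgroup.mem_bot] at this ⊢
    exact e.injective (by rw [map_one]; exact this)
  rw [eq_bot_iff]
  intro z hz
  rw [Subgroup.mem_bot]
  have hz' : e z ∈ Subgroup.centralizer ((N.map e.toMonoidHom : Subgroup H) : Set H) := by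
    rw [Subgroup.mem_centralizer_iff]
    rintro _ ⟨n, hn, rfl⟩
    change e n * e z = e z * e n
    rw [← map_mul, ← map_mul, (Subgroup.mem_centralizer_iff.mp hz) n hn]
  rw [hH _ inferInstance hne, Subgroup.mem_bot] at hz'
  exact e.injective (by rw [map_one]; exact hz')

namespace FundamentalExtension

/-! ### The second disjunct of p473904 is empty under (H′) -/

/-- **No commuting pair inside `Δ_E` under (H′).**  If every non-trivial normal subgroup of `Δ_E` has trivial
centraliser, then subgroups `R₀, S ≤ Δ_E` of `Π_E` with `R₀` normal in `Π_E`, `R₀ ≠ 1` and `[R₀, S] = 1` force `S = 1`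
(view `R₀` inside `Δ_E`: it is normal there, non-trivial, and `S ⊆ Δ_E` centralises it).
[cite: MochizukiAbsTopI2012, Thm 2.6 (v) p.22] -/
theorem eq_bot_of_commuting_pair (E : FundamentalExtension)
    (hH : ∀ N : Subgroup E.geom, N.Normal → N ≠ ⊥ → Subgroup.centralizer (N : Set E.geom) = ⊥)
    {R₀ S : Subgroup E.arith} (hR : R₀ ≤ E.geom) (hS : S ≤ E.geom) (hR0 : R₀ ≠ ⊥) (hRn : R₀.Normal)
    (hcomm : ∀ r ∈ R₀, ∀ s ∈ S, r * s = s * r) : S = ⊥ := by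
  haveI : (R₀.subgroupOf E.geom).Normal := hRn.subgroupOf E.geom
  have hN0 : R₀.subgroupOf E.geom ≠ ⊥ := fun h =>
    hR0 ((Subgroup.subgroupOf_eq_bot.mp h).eq_bot_of_le hR)
  rw [eq_bot_iff]
  intro s hs
  rw [Subgroup.mem_bot]
  have hmem : (⟨s, hS hs⟩ : E.geom) ∈ Subgroup.centralizer ((R₀.subgroupOf E.geom : Subgroup E.geom) : Set E.geom) := by
    rw [Subgroup.mem_centralizer_iff]
    rintro ⟨r, hrΔ⟩ hrN
    exact Subtype.ext (hcomm r (Subgroup.mem_subgroupOf.mp hrN) s hs)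
  rw [hH _ inferInstance hN0, Subgroup.mem_bot] at hmem
  exact congrArg Subtype.val hmem

/-- **The «projectivity route» closes under (H′): `φ` preserves `Δ`.**  For extensions `E`, `F` with MLF base data,
topologically finitely generated `Δ_E`, `Δ_F`, slim `G_E`, `Δ_E` `δ¹`-balanced at a prime `ℓ ≠ p`, an isomorphism
`φ : Π_E ⥲ Π_F`, a subgroup `A ≤ Π_F` centralising `Δ_F` whose image meets every open subgroup of `G_F` — the binders
of abc-iut-w6-d055's `preservesGeom_or_exists_commuting_pair` — AND (H′) for `Δ_E`: `PreservesGeom φ`.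
[cite: MochizukiAbsTopI2012, Thm 2.6 (v) p.22] -/
theorem MLFBase.preservesGeom_of_centralizer_eq_bot {E F : FundamentalExtension.{0}} (BE : E.MLFBase) (BF : F.MLFBase)
    (hΔE : IsTopologicallyFinitelyGenerated E.geom) (hΔF : IsTopologicallyFinitelyGenerated F.geom)
    (hslim : IsSlimGroup E.gal) (φ : E.arith ≃ₜ* F.arith)
    {ℓ : ℕ} [Fact ℓ.Prime] (hℓ : ℓ ≠ BF.p)
    (hbal : freeProlRank E.geom ℓ = @freeProlRank E.geom _ _ BF.p BF.instPrime)
    (A : Subgroup F.arith) (hA : A ≤ Subgroup.centralizer (F.geom : Set F.arith))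
    (hAU : ∀ U : Subgroup F.gal, IsOpen (U : Set F.gal) → A.map F.aug.toMonoidHom ⊓ U ≠ ⊥)
    (hH : ∀ N : Subgroup E.geom, N.Normal → N ≠ ⊥ → Subgroup.centralizer (N : Set E.geom) = ⊥) :
    PreservesGeom φ := by
  rcases MLFBase.preservesGeom_or_exists_commuting_pair BE BF hΔE hΔF hslim φ hℓ hbal A hA hAU with h |
    ⟨R₀, S, -, -, hR, hS, hR0, hS0, hRn, -, hcomm, -⟩
  · exact h
  · exact absurd (eq_bot_of_commuting_pair E hH hR hS hR0 hRn hcomm) hS0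

/-! ### (H′) for `Δ_E` BY NAME when `Δ_E` is free profinite of rank `≥ 2` -/

/-- (H′) for `Δ_E` from a group isomorphism `Δ_E ≃* F̂_n`, `n ≥ 2` (`F̂_n = profiniteCompletion (FreeGroup (Fin n))`).
[cite: MochizukiAbsAnab2004, Lemma 1.3.1 p.15] -/
theorem hprime_geom_of_mulEquiv_freeProfinite (E : FundamentalExtension) {n : ℕ} (hn : 2 ≤ n)
    (e : E.geom ≃* profiniteCompletion (FreeGroup (Fin n))) :
    ∀ N : Subgroup E.geom, N.Normal → N ≠ ⊥ → Subgroup.centralizer (N : Set E.geom) = ⊥ :=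
  fun N hN hN0 => centralizer_eq_bot_of_normal_of_mulEquiv e
    (fun M hM hM0 => by
      haveI := hM
      exact IsProSigmaCompletion.centralizer_eq_bot_of_normal_profiniteCompletion_freeGroup n hn M hM0)
    N hN hN0

/-- (H′) for `Δ_E` from a group isomorphism of `Δ_E` with an OPEN subgroup `U` of `F̂_n`, `n ≥ 2`.
[cite: MochizukiAbsAnab2004, Lemma 1.3.1 p.15] -/
theorem hprime_geom_of_mulEquiv_isOpen_freeProfinite (E : FundamentalExtension) {n : ℕ} (hn : 2 ≤ n)
    (U : Subgroup (profiniteCompletion (FreeGroup (Fin n))))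
    (hU : IsOpen (U : Set (profiniteCompletion (FreeGroup (Fin n))))) (e : E.geom ≃* U) :
    ∀ N : Subgroup E.geom, N.Normal → N ≠ ⊥ → Subgroup.centralizer (N : Set E.geom) = ⊥ :=
  fun N hN hN0 => centralizer_eq_bot_of_normal_of_mulEquiv e
    (fun M hM hM0 => by
      haveI := hM
      exact IsProSigmaCompletion.centralizer_eq_bot_of_normal_of_isOpen_profiniteCompletion_freeGroup n hn U hU M hM0)
    N hN hN0

/-- (H′) for `Δ_E` when `Δ_E` itself is free pro-`𝔓𝔯𝔦𝔪𝔢𝔰` of rank `n ≥ 2` on `gens` in the sense of [AbsTopI]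
Lemma 4.5 (i) (`IsFreeProOn`). [cite: MochizukiAbsTopI2012, Lemma 4.5 (i) p.54] -/
theorem hprime_geom_of_isFreeProOn (E : FundamentalExtension) {n : ℕ} (hn : 2 ≤ n) {gens : Fin n → E.geom}
    (h : IsFreeProOn E.geom {p : ℕ | p.Prime} gens) :
    ∀ N : Subgroup E.geom, N.Normal → N ≠ ⊥ → Subgroup.centralizer (N : Set E.geom) = ⊥ := by
  haveI : CompactSpace E.geom := isCompact_iff_compactSpace.mp E.isClosed_geom.isCompact
  intro N hN hN0
  haveI := hN
  exact IsProSigmaCompletion.centralizer_eq_bot_of_normal_of_isFreeProOn h hn N hN0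

/-! ### v2 (append-only): (H′) for `Δ_E` from ANY pro-`Σ` completion of a nonabelian free group
(the Tate-model shape sized by abc-iut-w4-d043 00:16:31Z: `Δ_E ≅ M̂₀`, `M₀ ≤ F₂` free of finite index) -/

/-- (H′) for `Δ_E` from a group isomorphism `Δ_E ≃* P` with `P` profinite and `ι : Γ → P` a pro-`Σ` completion
(`IsProSigmaCompletion`, `Σ` unbounded — e.g. `Σ = 𝔓𝔯𝔦𝔪𝔢𝔰`) of a NONABELIAN free group `Γ` (`IsFreeGroup`, any rank).
[cite: MochizukiAbsAnab2004, Lemma 1.3.1 p.15] -/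
theorem hprime_geom_of_mulEquiv_proSigmaCompletion (E : FundamentalExtension) {Sigma : Set ℕ}
    {Γ : Type*} [Group Γ] [IsFreeGroup Γ] {P : Type*} [Group P] [TopologicalSpace P] [IsTopologicalGroup P]
    [CompactSpace P] [T2Space P] [TotallyDisconnectedSpace P] {ι : Γ →* P}
    (hΓ : ∃ x y : Γ, x * y ≠ y * x) (hι : IsProSigmaCompletion Sigma ι)
    (hSig : ∀ m : ℕ, ∃ p ∈ Sigma, p.Prime ∧ m < p) (e : E.geom ≃* P) :
    ∀ N : Subgroup E.geom, N.Normal → N ≠ ⊥ → Subgroup.centralizer (N : Set E.geom) = ⊥ :=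
  fun N hN hN0 => centralizer_eq_bot_of_normal_of_mulEquiv e
    (fun M hM hM0 => by
      haveI := hM
      exact IsProSigmaCompletion.centralizer_eq_bot_of_normal hΓ hι hSig M hM0)
    N hN hN0

/-- (H′) for `Δ_E` from a group isomorphism `Δ_E ≃* M̂₀` with `M̂₀ = profiniteCompletion M₀` the profinite
completion of a NONABELIAN free group `M₀` (`IsFreeGroup`; e.g. a finite-index subgroup of `F₂`, free by
Nielsen–Schreier) — the shape of `Δ_E` at the [EtTh] Tate model. [cite: MochizukiAbsAnab2004, Lemma 1.3.1 p.15] -/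
theorem hprime_geom_of_mulEquiv_profiniteCompletion (E : FundamentalExtension) {M₀ : Type} [Group M₀]
    [IsFreeGroup M₀] (hM : ∃ x y : M₀, x * y ≠ y * x) (e : E.geom ≃* profiniteCompletion M₀) :
    ∀ N : Subgroup E.geom, N.Normal → N ≠ ⊥ → Subgroup.centralizer (N : Set E.geom) = ⊥ :=
  hprime_geom_of_mulEquiv_proSigmaCompletion E hM (IsProSigmaCompletion.isProSigmaCompletion_toCompletion M₀)
    (fun m => by
      obtain ⟨p, hmp, hp⟩ := Nat.exists_infinite_primes (m + 1)
      exact ⟨p, hp, hp, by omega⟩) e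

end FundamentalExtension

end Literature.AnabelianGeometry.AbsoluteAnabelian
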